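import Mathlib

/-!
# The two-point a priori estimate for the recessive solution of a three-term recurrence
# (kernel #235, lemmaR-A3 §8(y), PLAN §116)

Solo-blind programme, session s93.  Setting of kernel #234 (`SoloBlindRecessiveMonotone`): the
rotated streak block of the steady-door chain in regime (II) of LEMMA R⁺ is the difference
equation `u (k+2) - 2 u (k+1) + u k = c (k+1) · u (k+1)`, and the Jost lemma [L1] needs the
NON-RESONANCE bound `N = sup_k ‖u k‖ / ‖u 0‖ ≤ const` on the whole spectral strip, including
`Re x < 0` where no positivity is available.

The audit of s92 (finding F-s92-1) declared every m-side scheme circular in `N`.  This file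
records the algebra showing that the circularity is only apparent: comparing `u` with ANY
zero-free comparison sequence `W` (in practice the sampled continuum parabolic-cylinder
solution, or its `O(g²)`-corrected version) through the Casoratian
`C k = u k · W (k+1) - W k · u (k+1)` gives

* the ONE-STEP identity `C (k+1) = C k + u (k+1) · τ (k+1)` (`τ = L W` the defect of `W`),
  hence `C k = C 0 + Σ_{j<k} u (j+1) τ (j+1)` and the tail form `C j = C M - Σ_{j≤i<M} …`;
* REDUCTION OF ORDER: `u (k+1) / W (k+1) - u k / W k = - C k / (W k · W (k+1))`, hence the
  TWO-POINT REPRESENTATION `u k = W k · (u 0 / W 0 - Σ_{j<k} C j / (W j W (j+1)))`, normalised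
  at `k = 0` and fed at infinity through the Casoratian tail;
* the resulting normed TWO-POINT ESTIMATE `‖u k - u 0 · W k‖ ≤ ‖W k‖ Σ_{j<k} ‖C j‖/(‖W j‖‖W (j+1)‖)`;
* the LINEAR A PRIORI CLOSURE: a bound of the form `S ≤ ‖u 0‖ B + θ S` with `θ < 1` for the
  maximum `S` of `‖u k‖` forces `S ≤ ‖u 0‖ B / (1 - θ)` — so `u 0 ≠ 0` (non-resonance) is an
  OUTPUT, not an input;
* the PRINGSHEIM TAIL LEMMA: if `‖2 + c k‖ ≥ 2` beyond some index then the modulus of the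
  truncated recessive solution is non-increasing there (no energy argument needed), together
  with the elementary criterion `Re c ≥ -η`, `|Im c| ≥ 2√η` ⇒ `‖2 + c‖ ≥ 2`.

Numerically (work/edge_s93/apriori1.py, apriori2.py) the contraction constant is `θ* ≤ 0.09`
at `P_max` on the whole strip `|Re x| ≤ 12, |Im x| ≤ 1/4`, so [L1] follows on both half-strips
from the m-side alone.
-/

namespace Summit.AnomalousDissipation.AnomalousDissipation.Theorems

open Complex

/-- The Casoratian of two sequences at site `k`. -/
def casoratian (u W : ℕ → ℂ) (k : ℕ) : ℂ := u k * W (k + 1) - W k * u (k + 1)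

/-- ONE-STEP CASORATIAN IDENTITY.  If `u` solves the homogeneous row at site `k+1` and `W` has
defect `τ` there, then `C (k+1) = C k + u (k+1) · τ`. -/
theorem casoratian_step (u W : ℕ → ℂ) (c τ : ℂ) (k : ℕ)
    (hu : u (k + 2) - 2 * u (k + 1) + u k = c * u (k + 1))
    (hW : W (k + 2) - 2 * W (k + 1) + W k - c * W (k + 1) = τ) :
    casoratian u W (k + 1) = casoratian u W k + u (k + 1) * τ := by
  have h2 : u (k + 2) = c * u (k + 1) + 2 * u (k + 1) - u k := by
    rw [← hu]; ring
  unfold casoratian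
  rw [← hW, show k + 1 + 1 = k + 2 by ring, h2]
  ring

/-- SUMMED CASORATIAN IDENTITY: `C k = C 0 + Σ_{j<k} u (j+1) τ (j+1)` for `k ≤ K`. -/
theorem casoratian_sum (u W : ℕ → ℂ) (c τ : ℕ → ℂ) (K : ℕ)
    (hu : ∀ k, k + 1 ≤ K → u (k + 2) - 2 * u (k + 1) + u k = c (k + 1) * u (k + 1))
    (hW : ∀ k, k + 1 ≤ K → W (k + 2) - 2 * W (k + 1) + W k - c (k + 1) * W (k + 1) = τ (k + 1)) :
    ∀ k, k ≤ K → casoratian u W k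
      = casoratian u W 0 + (Finset.range k).sum (fun j => u (j + 1) * τ (j + 1)) := by
  intro k
  induction k with
  | zero => intro _; simp
  | succ k ih =>
    intro hk
    rw [Finset.sum_range_succ, casoratian_step u W (c (k + 1)) (τ (k + 1)) k (hu k hk) (hW k hk),
      ih (by omega)]
    ring

/-- TAIL FORM of the Casoratian: `C j = C M - Σ_{j ≤ i < M} u (i+1) τ (i+1)`; for the recessive
solution `C M → 0`, so the Casoratian at every site is fed from infinity. -/
theorem casoratian_tail (u W : ℕ → ℂ) (c τ : ℕ → ℂ) (M : ℕ)
    (hu : ∀ k, k + 1 ≤ M → u (k + 2) - 2 * u (k + 1) + u k = c (k + 1) * u (k + 1))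
    (hW : ∀ k, k + 1 ≤ M → W (k + 2) - 2 * W (k + 1) + W k - c (k + 1) * W (k + 1) = τ (k + 1))
    (j : ℕ) (hj : j ≤ M) :
    casoratian u W j = casoratian u W M
      - ((Finset.range M).sum (fun i => u (i + 1) * τ (i + 1))
          - (Finset.range j).sum (fun i => u (i + 1) * τ (i + 1))) := by
  have hM := casoratian_sum u W c τ M hu hW M le_rfl
  have hJ := casoratian_sum u W c τ M hu hW j hj
  linear_combination hJ - hM

/-- REDUCTION OF ORDER, one step: `u (k+1)/W (k+1) - u k/W k = - C k/(W k W (k+1))`. -/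
theorem reduction_of_order_step (u W : ℕ → ℂ) (k : ℕ) (h0 : W k ≠ 0) (h1 : W (k + 1) ≠ 0) :
    u (k + 1) / W (k + 1) - u k / W k = - casoratian u W k / (W k * W (k + 1)) := by
  unfold casoratian
  field_simp
  ring

/-- TWO-POINT REPRESENTATION (ratio form): for a comparison sequence `W` zero-free on `[0, K]`,
`u k / W k = u 0 / W 0 - Σ_{j<k} C j / (W j W (j+1))` for all `k ≤ K`. -/
theorem reduction_of_order_sum (u W : ℕ → ℂ) (K : ℕ) (hW : ∀ j, j ≤ K → W j ≠ 0) :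
    ∀ k, k ≤ K → u k / W k
      = u 0 / W 0 - (Finset.range k).sum (fun j => casoratian u W j / (W j * W (j + 1))) := by
  intro k
  induction k with
  | zero => intro _; simp
  | succ k ih =>
    intro hk
    rw [Finset.sum_range_succ]
    have h := reduction_of_order_step u W k (hW k (by omega)) (hW (k + 1) hk)
    have h' := ih (by omega)
    linear_combination h + h'

/-- TWO-POINT REPRESENTATION (product form): `u k = W k · (u 0 / W 0 - Σ_{j<k} C j/(W j W (j+1)))`. -/
theorem two_point_representation (u W : ℕ → ℂ) (K : ℕ) (hW : ∀ j, j ≤ K → W j ≠ 0)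
    (k : ℕ) (hk : k ≤ K) :
    u k = W k * (u 0 / W 0
      - (Finset.range k).sum (fun j => casoratian u W j / (W j * W (j + 1)))) := by
  rw [← reduction_of_order_sum u W K hW k hk]
  field_simp [hW k hk]

/-- TWO-POINT ESTIMATE: with `W 0 = 1`,
`‖u k - u 0 · W k‖ ≤ ‖W k‖ · Σ_{j<k} ‖C j‖ / (‖W j‖ ‖W (j+1)‖)`. -/
theorem two_point_estimate (u W : ℕ → ℂ) (K : ℕ) (hW : ∀ j, j ≤ K → W j ≠ 0) (hW0 : W 0 = 1)
    (k : ℕ) (hk : k ≤ K) :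
    ‖u k - u 0 * W k‖
      ≤ ‖W k‖ * (Finset.range k).sum (fun j => ‖casoratian u W j‖ / (‖W j‖ * ‖W (j + 1)‖)) := by
  have hrep := two_point_representation u W K hW k hk
  rw [hW0, div_one] at hrep
  have : u k - u 0 * W k
      = - (W k * (Finset.range k).sum (fun j => casoratian u W j / (W j * W (j + 1)))) := by
    rw [hrep]; ring
  rw [this, norm_neg, norm_mul]
  gcongr
  refine (norm_sum_le _ _).trans (le_of_eq ?_)
  apply Finset.sum_congr rfl
  intro j _
  rw [norm_div, norm_mul]

/-- LINEAR A PRIORI CLOSURE (abstract): `A ≤ a + θ A`, `θ < 1` ⇒ `A ≤ a / (1 - θ)`. -/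
theorem apriori_closure (A a θ : ℝ) (hθ : θ < 1) (h : A ≤ a + θ * A) : A ≤ a / (1 - θ) := by
  rw [le_div_iff₀ (by linarith)]
  have : A * (1 - θ) = A - θ * A := by ring
  rw [this]
  linarith

/-- NON-RESONANCE IS AN OUTPUT.  Let `S` be the maximum of `‖u k‖` over `k ≤ K` (attained), let
`‖W k‖ ≤ B` there, and suppose the two-point estimate has been bounded as
`‖u k - u 0 · W k‖ ≤ θ S` for `k ≤ K` with `θ < 1`.  Then `S ≤ ‖u 0‖ B / (1 - θ)`; in particular
`u 0 = 0` forces `u = 0` on `[0, K]`. -/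
theorem nonresonance_apriori (u W : ℕ → ℂ) (K : ℕ) (S B θ : ℝ) (hθ : θ < 1)
    (hB : ∀ k, k ≤ K → ‖W k‖ ≤ B)
    (hSatt : ∃ k, k ≤ K ∧ S ≤ ‖u k‖)
    (hnear : ∀ k, k ≤ K → ‖u k - u 0 * W k‖ ≤ θ * S) :
    S ≤ ‖u 0‖ * B / (1 - θ) := by
  obtain ⟨k, hk, hSk⟩ := hSatt
  apply apriori_closure S (‖u 0‖ * B) θ hθ
  have h1 : ‖u k‖ ≤ ‖u 0 * W k‖ + ‖u k - u 0 * W k‖ := by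
    have := norm_add_le (u 0 * W k) (u k - u 0 * W k)
    rwa [add_sub_cancel] at this
  have h2 : ‖u 0 * W k‖ ≤ ‖u 0‖ * B := by
    rw [norm_mul]
    exact mul_le_mul_of_nonneg_left (hB k hk) (norm_nonneg _)
  linarith [hnear k hk]

/-- Corollary: under the hypotheses of `nonresonance_apriori` with `S` a genuine bound,
`u 0 = 0` implies `u k = 0` for all `k ≤ K`. -/
theorem nonresonance_head_ne_zero (u W : ℕ → ℂ) (K : ℕ) (S B θ : ℝ) (hθ : θ < 1)
    (hB : ∀ k, k ≤ K → ‖W k‖ ≤ B)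
    (hS : ∀ k, k ≤ K → ‖u k‖ ≤ S) (hSatt : ∃ k, k ≤ K ∧ S ≤ ‖u k‖)
    (hnear : ∀ k, k ≤ K → ‖u k - u 0 * W k‖ ≤ θ * S) (h0 : u 0 = 0) :
    ∀ k, k ≤ K → u k = 0 := by
  have hSle := nonresonance_apriori u W K S B θ hθ hB hSatt hnear
  rw [h0, norm_zero, zero_mul, zero_div] at hSle
  intro k hk
  have : ‖u k‖ ≤ 0 := (hS k hk).trans hSle
  exact norm_le_zero_iff.mp this

/-- PRINGSHEIM TAIL LEMMA.  Rows `v k + v (k+2) = b (k+1) · v (k+1)` for `K ≤ k ≤ M`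
(i.e. `v (k+2) - 2 v (k+1) + v k = c (k+1) v (k+1)` with `b = 2 + c`), truncation
`v (M+2) = 0`, and `‖b k‖ ≥ 2` for `k ≥ K+1`: then `‖v (k+1)‖ ≤ ‖v k‖` for `K ≤ k ≤ M+1` — the
modulus of the truncated recessive solution is non-increasing on the tail. -/
theorem pringsheim_monotone (v b : ℕ → ℂ) (K M : ℕ)
    (hrow : ∀ k, K ≤ k → k ≤ M → v k + v (k + 2) = b (k + 1) * v (k + 1))
    (hb : ∀ k, K + 1 ≤ k → (2 : ℝ) ≤ ‖b k‖) (hM : v (M + 2) = 0) :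
    ∀ k, K ≤ k → k ≤ M + 1 → ‖v (k + 1)‖ ≤ ‖v k‖ := by
  have key : ∀ n k, k + n = M + 1 → K ≤ k → ‖v (k + 1)‖ ≤ ‖v k‖ := by
    intro n
    induction n with
    | zero =>
      intro k hk _
      have : k + 1 = M + 2 := by omega
      rw [this, hM, norm_zero]
      exact norm_nonneg _
    | succ n ih =>
      intro k hk hK
      have hkM : k ≤ M := by omega
      have ih' := ih (k + 1) (by omega) (by omega)
      have hr := hrow k hK hkM
      have hn : ‖b (k + 1)‖ * ‖v (k + 1)‖ ≤ ‖v k‖ + ‖v (k + 2)‖ := by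
        rw [← norm_mul, ← hr]
        exact norm_add_le _ _
      have hb' := hb (k + 1) (by omega)
      have hk2 : ‖v (k + 1 + 1)‖ = ‖v (k + 2)‖ := rfl
      rw [hk2] at ih'
      nlinarith [norm_nonneg (v (k + 1)), norm_nonneg (v (k + 2))]
  intro k hK hk
  exact key (M + 1 - k) k (by omega) hK

/-- MODULUS CRITERION for the Pringsheim lemma: `Re c ≥ -η`, `0 ≤ η ≤ 2`, `|Im c| ≥ 2 √η`
⇒ `‖2 + c‖ ≥ 2` (since `(2-η)² + 4η = 4 + η²`).  For the streak block
`c k = 2 sc·x + i sc² (1 - 2k²)` this holds as soon as `sc² (2k² - 1) - 2 sc·Im x ≥ 2 √(2 sc |Re x|)`,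
i.e. from `y_k = k g ≈ (4|Re x|/sc)^{1/4}` on. -/
theorem two_add_norm_ge_two (c : ℂ) (η : ℝ) (hη0 : 0 ≤ η) (hη2 : η ≤ 2)
    (hre : -η ≤ c.re) (him : 2 * Real.sqrt η ≤ |c.im|) : (2 : ℝ) ≤ ‖2 + c‖ := by
  have hsq : ‖(2 : ℂ) + c‖ ^ 2 = (2 + c.re) ^ 2 + c.im ^ 2 := by
    rw [← Complex.normSq_eq_norm_sq, Complex.normSq_apply]
    simp only [Complex.add_re, Complex.add_im, Complex.re_ofNat, Complex.im_ofNat]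
    ring
  have him2 : 4 * η ≤ c.im ^ 2 := by
    have hs : (Real.sqrt η) ^ 2 = η := Real.sq_sqrt hη0
    have hab : (2 * Real.sqrt η) ^ 2 ≤ |c.im| ^ 2 := by
      apply pow_le_pow_left₀ (by positivity) him
    rw [sq_abs] at hab
    nlinarith [hab, hs]
  have hre2 : (2 - η) ^ 2 ≤ (2 + c.re) ^ 2 := by
    apply pow_le_pow_left₀ (by linarith) (by linarith)
  have h4 : (4 : ℝ) ≤ ‖(2 : ℂ) + c‖ ^ 2 := by
    rw [hsq]; nlinarith [hre2, him2]
  nlinarith [norm_nonneg ((2 : ℂ) + c), h4]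

end Summit.AnomalousDissipation.AnomalousDissipation.Theorems
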